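import Literature.Analysis.DeBrangesSpaces.SonineMellinEntire
import Mathlib.Analysis.Complex.Liouville
import HarnessLib

/-!
# Burnol 2001 (CRAS 333), §1: the pairing identity `(f, X^λ_{w,k}] = (d/dw)^k(γ₊(w)f̂(1−w))` for
`Re w ≤ 1/2` — `w`-derivatives of `C_λ(u,w)` and differentiation of `∫_λ^∞ f(u)C_λ(u,w)du`

For `Re w ≤ 1/2` Burnol sets `X^λ_{w,k}(t) = 𝟙_{t≥λ}(d^k/d^kw)C_λ(t,w)` and states
"`(f, X^λ_{w,k}] = (d^k/d^kw)(γ₊(w)f̂(1−w))`" (TeX l.393–400), the compensated product being (by (1.1))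
the entire continuation `G_{𝓕f}(w) = ∫_λ^∞ f(u)C_λ(u,w)du` of `(𝓕₊f)^`.  We prove:

* `exists_bound_iteratedDeriv_cosKernel`: Cauchy estimates `‖∂_w^k C_a(u,w)‖ ≤ K(k,R)/|u|`
  (`|u| ≥ u₀ > 0`, `‖w‖ ≤ R`), from the tree's `O(1/u)` bound `exists_bound_cosKernel`;
* `hasDerivAt_setIntegral_mul_iteratedDeriv_cosKernel`, `iteratedDeriv_sonineMellinExt`:
  `(d/dw)^k ∫_b^∞ F(u)C_a(u,w)du = ∫_b^∞ F(u) ∂_w^k C_a(u,w) du` for `F ∈ L²`, all `w ∈ ℂ`;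
* (sequel file `BurnolXPairingKernelIdentity.lean`) for `f ∈ K_{λ,λ}` and the faithful compensated
  pairing function (`IsXPairingFnC`), `xPairingR G P w k = ∫_λ^∞ f(u) ∂_w^k C_λ(u,w) du` on
  `Re w ≤ 1/2` — the printed identity.

Brick 2b of the proof of Théorème 1.5 (`Burnol2001CRAS_thm1_5C`). RH-FREE.

## References
* [Burnol2001CRAS] J.-F. Burnol, C. R. Acad. Sci. Paris 333 (2001) 201–206, §1, Lemme 1.3
  (TeX l.358–367), TeX l.393–403.
-/

open MeasureTheory Set Filter Complex Metric
open scoped Real Topology ENNReal FourierTransform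

open Literature.Analysis.DeBrangesSpaces.SonineMellin (cosKernel sonineMellinExt
  differentiable_cosKernel continuousOn_cosKernel exists_bound_cosKernel
  differentiable_sonineMellinExt)

namespace Literature.Analysis.DeBrangesSpaces

namespace Burnol2001

/-! ## A. Cauchy estimates for `∂_w^k C_a(u,w)` -/

/-- The iterated `w`-derivatives of the entire function `w ↦ C_a(u,w)` are entire (`u ≠ 0`).
[cite: Burnol2001CRAS, Lemme 1.2 (TeX l.354–355)] -/
theorem differentiable_iteratedDeriv_cosKernel {a u : ℝ} (ha : 0 < a) (hu : u ≠ 0) (k : ℕ) :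
    Differentiable ℂ (iteratedDeriv k (cosKernel a u)) :=
  (differentiable_cosKernel ha hu).contDiff.differentiable_iteratedDeriv k
    (WithTop.coe_lt_top (k : ℕ∞))

/-- **Cauchy estimates: `‖∂_w^k C_a(u,w)‖ ≤ K(k,R)/|u|`** for `|u| ≥ u₀ > 0`, `‖w‖ ≤ R` (from the
`O(1/u)` clause of Lemme 1.3, uniform on `‖w‖ ≤ R + k`, and Cauchy's inequality on unit circles).
[cite: Burnol2001CRAS, Lemme 1.3 (TeX l.358–367)] -/
theorem exists_bound_iteratedDeriv_cosKernel {a : ℝ} (ha : 0 < a) {u₀ : ℝ} (hu₀ : 0 < u₀) (k : ℕ)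
    (R : ℝ) : ∃ K : ℝ, 0 ≤ K ∧ ∀ (u : ℝ) (w : ℂ), u₀ ≤ |u| → ‖w‖ ≤ R →
      ‖iteratedDeriv k (cosKernel a u) w‖ ≤ K / |u| := by
  induction k generalizing R with
  | zero =>
    obtain ⟨K, hK0, hK⟩ := exists_bound_cosKernel ha hu₀ R
    exact ⟨K, hK0, fun u w hu hw ↦ by rw [iteratedDeriv_zero]; exact hK u w hu hw⟩
  | succ k ih =>
    obtain ⟨K, hK0, hK⟩ := ih (R + 1)
    refine ⟨K, hK0, fun u w hu hw ↦ ?_⟩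
    have hu0 : u ≠ 0 := fun h ↦ by rw [h, abs_zero] at hu; linarith
    rw [iteratedDeriv_succ]
    have hd : DiffContOnCl ℂ (iteratedDeriv k (cosKernel a u)) (ball w 1) :=
      (differentiable_iteratedDeriv_cosKernel ha hu0 k).diffContOnCl
    have h := Complex.norm_deriv_le_of_forall_mem_sphere_norm_le zero_lt_one hd
      (C := K / |u|) fun z hz ↦ hK u z hu ?_
    · simpa using h
    · have h1 : ‖z - w‖ = 1 := by simpa [dist_eq_norm] using hz
      calc ‖z‖ = ‖w + (z - w)‖ := by ring_nf
        _ ≤ ‖w‖ + ‖z - w‖ := norm_add_le _ _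
        _ ≤ R + 1 := by rw [h1]; linarith

/-- `K·u^{−1} ∈ L²((b,∞))` for `b > 0`. [folklore] -/
private theorem memLp_const_mul_rpow_neg_one {b : ℝ} (hb : 0 < b) (K : ℝ) :
    MemLp (fun u : ℝ ↦ K * u ^ (-(1 : ℝ))) 2 (volume.restrict (Ioi b)) := by
  have hI : IntegrableOn (fun u : ℝ ↦ K ^ 2 * u ^ (-2 : ℝ)) (Ioi b) :=
    (integrableOn_Ioi_rpow_of_lt (by norm_num : (-2 : ℝ) < -1) hb).const_mul (K ^ 2)
  have hmeas : AEStronglyMeasurable (fun u : ℝ ↦ K * u ^ (-(1 : ℝ))) (volume.restrict (Ioi b)) := by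
    refine ContinuousOn.aestronglyMeasurable (fun u hu ↦ ?_) measurableSet_Ioi
    exact (continuousAt_const.mul (Real.continuousAt_rpow_const _ _
      (Or.inl (hb.trans hu).ne'))).continuousWithinAt
  rw [memLp_two_iff_integrable_sq_norm hmeas]
  refine hI.congr_fun (fun u hu ↦ ?_) measurableSet_Ioi
  have hu0 : 0 < u := hb.trans hu
  dsimp only
  rw [Real.norm_eq_abs, sq_abs, mul_pow, ← Real.rpow_natCast (u ^ (-(1:ℝ))), ← Real.rpow_mul hu0.le]
  norm_num

/-! ## B. Differentiating `∫_b^∞ F(u) C_a(u,w) du` under the integral sign -/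

section Main

variable {a b : ℝ} (ha : 0 < a) (hb : 0 < b) (F : Lp ℂ 2 (volume : Measure ℝ))

include ha hb in
/-- `u ↦ ∂_w^k C_a(u,w)` is measurable on `(b,∞)` (a pointwise limit of difference quotients of
functions continuous in `u`). [folklore] -/
private theorem aestronglyMeasurable_iteratedDeriv_cosKernel (k : ℕ) (w : ℂ) :
    AEStronglyMeasurable (fun u : ℝ ↦ iteratedDeriv k (cosKernel a u) w) (volume.restrict (Ioi b)) := by
  induction k generalizing w with
  | zero =>
    simp only [iteratedDeriv_zero]
    exact ((continuousOn_cosKernel ha w).mono fun u hu ↦ (hb.trans hu).ne').aestronglyMeasurable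
      measurableSet_Ioi
  | succ k ih =>
    -- difference quotients along `w + 1/(n+1)`
    set h : ℕ → ℂ := fun n ↦ ((1 / ((n : ℝ) + 1) : ℝ) : ℂ) with hh
    have hh0 : ∀ n, h n ≠ 0 := fun n ↦ by
      have h1 : (1 / ((n : ℝ) + 1) : ℝ) ≠ 0 := by positivity
      rw [hh]
      exact Complex.ofReal_ne_zero.2 h1
    have hlim : Tendsto h atTop (𝓝[≠] 0) := by
      refine tendsto_nhdsWithin_iff.2 ⟨?_, Eventually.of_forall fun n ↦ hh0 n⟩
      have := (Complex.continuous_ofReal.tendsto 0).comp tendsto_one_div_add_atTop_nhds_zero_nat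
      rwa [Complex.ofReal_zero] at this
    refine aestronglyMeasurable_of_tendsto_ae atTop
      (f := fun n u ↦ (h n)⁻¹ • (iteratedDeriv k (cosKernel a u) (w + h n) -
        iteratedDeriv k (cosKernel a u) w)) (fun n ↦ ?_) ?_
    · exact ((ih (w + h n)).sub (ih w)).const_smul ((h n)⁻¹)
    filter_upwards [ae_restrict_mem measurableSet_Ioi] with u hu
    have hu0 : u ≠ 0 := (hb.trans hu).ne'
    rw [iteratedDeriv_succ]
    have hd := ((differentiable_iteratedDeriv_cosKernel ha hu0 k) w).hasDerivAt
    rw [hasDerivAt_iff_tendsto_slope_zero] at hd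
    have := hd.comp hlim
    refine this.congr fun n ↦ ?_
    simp only [Function.comp_apply]

include ha hb in
/-- `F(u) ∂_w^k C_a(u,w)` is integrable on `(b,∞)` for `F ∈ L²` (`∂^kC = O(1/u)`).
[cite: Burnol2001CRAS, Lemme 1.3 (TeX l.358–367)] -/
theorem integrableOn_mul_iteratedDeriv_cosKernel (k : ℕ) (w : ℂ) :
    IntegrableOn (fun u : ℝ ↦ (F : ℝ → ℂ) u * iteratedDeriv k (cosKernel a u) w) (Ioi b) := by
  obtain ⟨K, hK0, hK⟩ := exists_bound_iteratedDeriv_cosKernel ha hb k ‖w‖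
  -- `∂^kC(·,w) ∈ L²((b,∞))`: dominated by `K/u`
  have h2 : MemLp (fun u : ℝ ↦ iteratedDeriv k (cosKernel a u) w) 2 (volume.restrict (Ioi b)) := by
    have hmaj : MemLp (fun u : ℝ ↦ ((K * u ^ (-(1 : ℝ)) : ℝ) : ℂ)) 2 (volume.restrict (Ioi b)) :=
      (memLp_const_mul_rpow_neg_one hb K).ofReal
    refine MemLp.of_le hmaj (aestronglyMeasurable_iteratedDeriv_cosKernel ha hb k w) ?_
    filter_upwards [ae_restrict_mem measurableSet_Ioi] with u hu
    have hu0 : 0 < u := hb.trans hu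
    have h1 := hK u w (by rw [abs_of_pos hu0]; exact hu.le) le_rfl
    rw [abs_of_pos hu0] at h1
    rw [Complex.norm_real, Real.norm_eq_abs, abs_of_nonneg (by positivity), Real.rpow_neg_one,
      ← div_eq_mul_inv]
    exact h1
  exact ((Lp.memLp F).restrict (Ioi b)).integrable_mul h2

include ha hb in
/-- **Differentiation under the integral sign**:
`d/dw ∫_b^∞ F(u) ∂_w^k C_a(u,w) du = ∫_b^∞ F(u) ∂_w^{k+1} C_a(u,w) du` at every `w₀ ∈ ℂ`.
[cite: Burnol2001CRAS, §1 (TeX l.393–400)] -/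
theorem hasDerivAt_setIntegral_mul_iteratedDeriv_cosKernel (k : ℕ) (w₀ : ℂ) :
    HasDerivAt (fun w : ℂ ↦ ∫ u in Ioi b, (F : ℝ → ℂ) u * iteratedDeriv k (cosKernel a u) w)
      (∫ u in Ioi b, (F : ℝ → ℂ) u * iteratedDeriv (k + 1) (cosKernel a u) w₀) w₀ := by
  obtain ⟨K, hK0, hK⟩ := exists_bound_iteratedDeriv_cosKernel ha hb (k + 1) (‖w₀‖ + 1)
  set G : ℂ → ℝ → ℂ := fun w u ↦ (F : ℝ → ℂ) u * iteratedDeriv k (cosKernel a u) w with hG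
  set G' : ℂ → ℝ → ℂ := fun w u ↦ (F : ℝ → ℂ) u * iteratedDeriv (k + 1) (cosKernel a u) w with hG'
  set bound : ℝ → ℝ := fun u ↦ ‖(F : ℝ → ℂ) u‖ * (K * u ^ (-(1 : ℝ))) with hbound
  have hmeas : ∀ w : ℂ, AEStronglyMeasurable (G w) (volume.restrict (Ioi b)) := fun w ↦
    (Lp.aestronglyMeasurable F).restrict.mul (aestronglyMeasurable_iteratedDeriv_cosKernel ha hb k w)
  have key := hasDerivAt_integral_of_dominated_loc_of_deriv_le (μ := volume.restrict (Ioi b))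
    (x₀ := w₀) (F := G) (F' := G') (bound := bound) (ball_mem_nhds w₀ zero_lt_one)
    (Eventually.of_forall hmeas) (integrableOn_mul_iteratedDeriv_cosKernel ha hb F k w₀)
    ((Lp.aestronglyMeasurable F).restrict.mul
      (aestronglyMeasurable_iteratedDeriv_cosKernel ha hb (k + 1) w₀)) ?_ ?_ ?_
  · exact key.2
  · filter_upwards [ae_restrict_mem measurableSet_Ioi] with u hu w hw
    have hu0 : 0 < u := hb.trans hu
    rw [hG', hbound]; dsimp only
    rw [norm_mul]
    refine mul_le_mul_of_nonneg_left ?_ (norm_nonneg _)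
    have hw' : ‖w‖ ≤ ‖w₀‖ + 1 := by
      have h1 : ‖w - w₀‖ < 1 := mem_ball_iff_norm.1 hw
      calc ‖w‖ = ‖w₀ + (w - w₀)‖ := by ring_nf
        _ ≤ ‖w₀‖ + ‖w - w₀‖ := norm_add_le _ _
        _ ≤ ‖w₀‖ + 1 := by linarith
    have h1 := hK u w (by rw [abs_of_pos hu0]; exact le_of_lt hu) hw'
    rw [abs_of_pos hu0] at h1
    rwa [Real.rpow_neg_one, ← div_eq_mul_inv]
  · exact ((Lp.memLp F).restrict (Ioi b)).norm.integrable_mul (memLp_const_mul_rpow_neg_one hb K)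
  · filter_upwards [ae_restrict_mem measurableSet_Ioi] with u hu w _
    have hu0 : u ≠ 0 := (hb.trans hu).ne'
    rw [hG, hG']; dsimp only
    rw [iteratedDeriv_succ]
    exact (((differentiable_iteratedDeriv_cosKernel ha hu0 k) w).hasDerivAt).const_mul _

include ha hb in
/-- **`(d/dw)^k ∫_b^∞ F(u)C_a(u,w)du = ∫_b^∞ F(u) ∂_w^k C_a(u,w) du`** for `F ∈ L²` and every `w`.
[cite: Burnol2001CRAS, §1 (TeX l.393–400)] -/
theorem iteratedDeriv_sonineMellinExt (k : ℕ) (w : ℂ) :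
    iteratedDeriv k (sonineMellinExt a b (F : ℝ → ℂ)) w =
      ∫ u in Ioi b, (F : ℝ → ℂ) u * iteratedDeriv k (cosKernel a u) w := by
  induction k generalizing w with
  | zero =>
    simp only [iteratedDeriv_zero]
    rfl
  | succ k ih =>
    rw [iteratedDeriv_succ]
    have hev : iteratedDeriv k (sonineMellinExt a b (F : ℝ → ℂ)) =
        fun w ↦ ∫ u in Ioi b, (F : ℝ → ℂ) u * iteratedDeriv k (cosKernel a u) w := funext ih
    rw [hev]
    exact (hasDerivAt_setIntegral_mul_iteratedDeriv_cosKernel ha hb F k w).deriv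

end Main

end Burnol2001

end Literature.Analysis.DeBrangesSpaces
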